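import Summits.QuantumFields.YangMills.Theorems.DiagonalMirrorRPRWilsonDiagonalModelSpectralTrace

/-!
# Crux `DiagonalMirrorRPR` (stmt-QuantumFields-10604), line `sign-twisted-diagonal-trace`, construction F1_diag
# (director-ym O4 WORD 3 (A)), S5: ★★ spectral data `sp / sm / top` of one diagonal slice — the nine spectral fields of `DiagonalSliceModel`

Helper for the crux `DiagonalMirrorRPR` of `YangMills` (routes `IsotropyFromPowerCounting`, `MirrorModularBoosts`,
`PencilRigidity`; item stmt-QuantumFields-10604), attached `--supports … --as helper`; it closes nothing by itself.

* `pow_extend_zero`, `pow_eq_posPart_add_negPart`, `exists_max_of_summable_sq`, `posPad`, `negPad` — bookkeeping;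
* ★ `exists_eigenPackage` — the eigen-package EXPORTED (bond bound `M`, operator `A` of `𝔟` on `L²(μ̃)`, Hilbert basis `b` of
  eigenvectors on a countable index set, eigenvalues `κ`, `Σκ² < ∞`, `HasSum (κᵢ^{M+2}) (diagCyclicTraceU ρ β (M+2))`) — the
  pairing layer needs the eigenFUNCTIONS;
* ★★ `spectralData_of_hasSum` — for ANY `κ` with `Σκ² < ∞` and the trace formula, and any injection `e : ι → ℕ`, the padded
  positive/negative parts `posPad e κ`, `negPad e κ` carry the nine spectral fields (same `ℕ`-indexing as the future `wp/wm`);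
* ★★ **`exists_spectralData`** — for odd `S ≥ 3`, `β ≥ 0`, `ρ` continuous unitary: sequences `sp, sm : ℕ → ℝ` and `top > 0`
  with `0 ≤ sp, sm ≤ top`, `top` attained, `Σ sp² < ∞`, `Σ sm² < ∞`, `sp · sm = 0`, the trace identities
  `Σ' sp^m + (-1)^m Σ' sm^m = diagCyclicTraceU ρ β m` (`m ≥ 2`), hence `Σ' sm^m ≤ Σ' sp^m` (odd `m ≥ 3`) and
  `Σ' sm^S < Σ' sp^S` — exactly the fields `top_pos, sp_nonneg, sm_nonneg, sp_le, sm_le, top_attained, summable_sp,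
  summable_sm, trace_nonneg, trace_side_pos` of `DiagonalSliceModel r sch` at a scheme index `k` with `sch.side k = S ≥ 3`
  (`S = 2 L_k + 1`; for the finitely-irrelevant indices with `L_k = 0` the model may carry dummy data, all remaining fields of
  the interface being `∀ᶠ k`).

WHAT REMAINS for `def wilsonDiagonalModel r sch hβ : DiagonalSliceModel r sch` (OWED, not in this seat): the PAIRING layer
(`wp, wm, depth, depth_le, pairing_eq, weight_dom`) — eigenFUNCTION sandwich formulas for `gramPairing`/`famObs` of reflected
families in the `u`-chart (tree pattern: `HermitianKernelSandwichedTrace`, `PositiveKernelSpectralTraceTwo.hasSum_integral_iterate_insert_two`,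
applied to `𝔟` on `μ̃`), and the assembly `def`.  HONEST FRAMING: construction helper; nothing about D_old ⟨10604⟩, the RP
crux of the FOLD restate, or the summit is proved; the Yang–Mills mass gap is NOT proved here or anywhere in the tree.
-/

set_option autoImplicit false

noncomputable section

open scoped BigOperators ENNReal
open MeasureTheory Function Filter
open Literature.MathematicalPhysics.QuantumLattice Literature.MathematicalPhysics.QuantumFieldTheory
open Summit.QuantumFields.YangMills.Cruxes.DiagonalMirrorRPR.ParityBridgeColdTraces

namespace Summit.QuantumFields.YangMills.Cruxes.DiagonalMirrorRPR.SignTwistedDiagonalTrace.WilsonDiagonal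

/-! ## §32 Spectral data `sp / sm / top` of one slice (the nine spectral fields of `DiagonalSliceModel` at fixed `k`) -/

section SpectralDataLemmas

/-- Powers commute with zero-extension along an index map (`m ≠ 0`). -/
theorem pow_extend_zero {ι : Type} (e : ι → ℕ) (g : ι → ℝ) {m : ℕ} (hm : m ≠ 0) :
    (fun j => Function.extend e g 0 j ^ m) = Function.extend e (fun i => g i ^ m) 0 := by
  funext j
  have h := Function.apply_extend (g := g) (fun x : ℝ => x ^ m) e 0 j
  have h0 : ((fun x : ℝ => x ^ m) ∘ (0 : ℕ → ℝ)) = 0 := by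
    funext i
    simp [zero_pow hm]
  rw [h, h0]
  rfl

/-- `λ^m = (λ⁺)^m + (-1)^m (λ⁻)^m` with `λ⁺ = max λ 0`, `λ⁻ = max (-λ) 0` (`m ≠ 0`). -/
theorem pow_eq_posPart_add_negPart (x : ℝ) {m : ℕ} (hm : m ≠ 0) :
    x ^ m = max x 0 ^ m + (-1) ^ m * max (-x) 0 ^ m := by
  rcases le_total 0 x with hx | hx
  · rw [max_eq_left hx, max_eq_right (neg_nonpos.2 hx), zero_pow hm, mul_zero, add_zero]
  · rw [max_eq_right hx, max_eq_left (neg_nonneg.2 hx), zero_pow hm, zero_add, ← mul_pow, neg_one_mul, neg_neg]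

/-- A non-negative square-summable sequence that is not identically zero attains its supremum. -/
theorem exists_max_of_summable_sq {f : ℕ → ℝ} (hf0 : ∀ j, 0 ≤ f j) (hf : Summable fun j => f j ^ 2)
    {j₁ : ℕ} (hj₁ : 0 < f j₁) : ∃ j₀, 0 < f j₀ ∧ ∀ j, f j ≤ f j₀ := by
  have ht := hf.tendsto_cofinite_zero
  have hev : ∀ᶠ j in cofinite, f j ^ 2 < f j₁ ^ 2 := by
    have h := ht.eventually (gt_mem_nhds (pow_pos hj₁ 2))
    exact h
  have hfin : Set.Finite {j | ¬ f j ^ 2 < f j₁ ^ 2} := Filter.eventually_cofinite.1 hev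
  set s : Finset ℕ := hfin.toFinset with hs
  have hj₁s : j₁ ∈ s := by
    rw [hs, Set.Finite.mem_toFinset]
    exact lt_irrefl _
  obtain ⟨j₀, hj₀s, hmax⟩ := Finset.exists_max_image s f ⟨j₁, hj₁s⟩
  refine ⟨j₀, hj₁.trans_le (hmax j₁ hj₁s), fun j => ?_⟩
  by_cases hj : j ∈ s
  · exact hmax j hj
  · rw [hs, Set.Finite.mem_toFinset, Set.mem_setOf_eq, not_not] at hj
    have h2 : f j ^ 2 < f j₀ ^ 2 := hj.trans_le (pow_le_pow_left₀ (hf0 _) (hmax j₁ hj₁s) 2)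
    exact le_of_lt (lt_of_pow_lt_pow_left₀ 2 (hf0 _) h2)

/-- The positive parts `max κᵢ 0` of a family `κ : ι → ℝ`, transported along `e : ι → ℕ` and padded with zeros. -/
def posPad {ι : Type} (e : ι → ℕ) (κ : ι → ℝ) : ℕ → ℝ := Function.extend e (fun i => max (κ i) 0) 0

/-- The negative parts `max (-κᵢ) 0` of a family `κ : ι → ℝ`, transported along `e : ι → ℕ` and padded with zeros. -/
def negPad {ι : Type} (e : ι → ℕ) (κ : ι → ℝ) : ℕ → ℝ := Function.extend e (fun i => max (-κ i) 0) 0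

end SpectralDataLemmas

section SpectralData

variable {S : ℕ} [NeZero S] {G : Type} [Group G] {Nc : ℕ} (ρ : G →* Matrix (Fin Nc) (Fin Nc) ℂ)
variable [TopologicalSpace G] [IsTopologicalGroup G] [CompactSpace G] [MeasurableSpace G] [BorelSpace G]
  [SecondCountableTopology G]

/-- ★ **The eigen-package of one diagonal slice, exported** (`β ≥ 0`, `ρ` continuous unitary): a bond bound `M`, the
integral operator `A` of the bounded reweighted lifted kernel `𝔟 = bKernel ρ β M` on `L²(μ̃)`, `μ̃ = tMeasure S G Nc β M`
(self-adjoint, compact), a Hilbert basis `b` of eigenvectors indexed by a countable set `s`, `A bᵢ = κᵢ bᵢ`, with `Σ κᵢ² < ∞`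
and the trace formula `HasSum (κᵢ^{M'+2}) (diagCyclicTraceU ρ β (M'+2))`.  (The proof of
`exists_eigen_hasSum_pow_diagCyclicTraceU` with its witnesses kept — the pairing layer needs the eigenFUNCTIONS `bᵢ`.) -/
theorem exists_eigenPackage (hρ : Continuous ρ) {β : ℝ} (hβ : 0 ≤ β)
    (hρu : ∀ g, ρ g ∈ Matrix.unitaryGroup (Fin Nc) ℂ) :
    ∃ (M : ℝ) (A : Lp ℝ 2 (tMeasure S G Nc β M) →L[ℝ] Lp ℝ 2 (tMeasure S G Nc β M))
      (s : Set (Lp ℝ 2 (tMeasure S G Nc β M))) (b : HilbertBasis s ℝ (Lp ℝ 2 (tMeasure S G Nc β M))) (κ : s → ℝ),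
      (∀ (Y : HalfCfg S S G) (j : Fin (featDim S Nc)), |bondVec ρ Y j| ≤ M) ∧
      (∀ φ : Lp ℝ 2 (tMeasure S G Nc β M), (A φ : ℕ × HalfCfg S S G → ℝ) =ᵐ[tMeasure S G Nc β M]
        fun x => ∫ y, bKernel ρ β M x y * φ y ∂(tMeasure S G Nc β M)) ∧
      IsSelfAdjoint A ∧ IsCompactOperator A ∧ ⇑b = ((↑) : s → Lp ℝ 2 (tMeasure S G Nc β M)) ∧
      (∀ i, A (b i) = κ i • b i) ∧ Countable s ∧ Summable (fun i => κ i ^ 2) ∧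
      ∀ M' : ℕ, HasSum (fun i => κ i ^ (M' + 2)) (diagCyclicTraceU ρ β (M' + 2) (S := S) (G := G)) := by
  obtain ⟨M, hM⟩ := exists_abs_bondVec_le (S := S) ρ hρ
  haveI := isFiniteMeasure_tMeasure (S := S) (G := G) (Nc := Nc) hβ M
  haveI : SecondCountableTopology (Lp ℝ 2 (tMeasure S G Nc β M)) := secondCountableTopology_Lp_tMeasure β M
  have hK := stronglyMeasurable_bKernel (S := S) ρ hρ β M
  obtain ⟨C, hC⟩ := exists_abs_bKernel_le ρ hρ β hM
  have hsymm := bKernel_symm (S := S) ρ β M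
  have hC0 : 0 ≤ C := (norm_nonneg _).trans (hC ((0 : ℕ), fun _ => (1 : G)) ((0 : ℕ), fun _ => (1 : G)))
  obtain ⟨A, hA⟩ := Literature.Analysis.OperatorTheory.exists_kernelOp (μ := tMeasure S G Nc β M) hK hC
  have hsa := Literature.Analysis.OperatorTheory.isSelfAdjoint_kernelOp hK hC hsymm hA
  have hcpt := Literature.Analysis.OperatorTheory.isCompactOperator_kernelOp hC hC0 hA
  obtain ⟨s, b, κ, hb, hκ⟩ :=
    Literature.Analysis.OperatorTheory.exists_hilbertBasis_eigenvectors_of_isSelfAdjoint hcpt hsa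
  have hκ' : ∀ i, A (b i) = κ i • b i := fun i => by simpa using hκ i
  haveI hcount : Countable s := countable_of_orthonormal b.orthonormal
  refine ⟨M, A, s, b, κ, hM, hA, hsa, hcpt, hb, hκ', hcount,
    (Literature.Analysis.OperatorTheory.hasSum_lam_sq hK hC hA hκ').summable, fun M' => ?_⟩
  have h := hasSum_pow_integral_cyclic_signed hK hC hsymm hA hκ' M'
  rw [integral_cyclic_bKernel_eq ρ hρ hβ hM (M' + 2)] at h
  rw [diagCyclicTraceU_eq_tsum_integral_natKernel ρ hρ hβ hρu (M' + 2)]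
  exact h

/-- ★★ **Spectral data of one diagonal slice from an eigen-package** (odd side `S ≥ 3`): for ANY family `κ : ι → ℝ` with
`Σ κᵢ² < ∞` and the trace formula `HasSum (κᵢ^{M'+2}) (diagCyclicTraceU ρ β (M'+2))` (e.g. the one of `exists_eigenPackage`)
and any injection `e : ι → ℕ`, the padded positive / negative parts `sp = posPad e κ`, `sm = negPad e κ` and some `top > 0`
satisfy: non-negativity, `sp, sm ≤ top`, attainment, square-summability, disjointness, the **trace identities**
`Σ' sp^m + (-1)^m Σ' sm^m = diagCyclicTraceU ρ β m = Tr K_u^m` (`m ≥ 2`), `Σ' sm^m ≤ Σ' sp^m` for odd `m ≥ 3`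
(`Tr K_u^m ≥ 0`, `diagCyclicTraceU_nonneg`) and `Σ' sm^S < Σ' sp^S` (`Tr K_u^S > 0`, `diagCyclicTraceU_side_pos`) — the nine
spectral fields `top_pos … trace_side_pos` of `DiagonalSliceModel` at a fixed scheme index, in the SAME `ℕ`-indexing `e` that
the pairing weights `wp/wm` (matrix elements in the eigenbasis) will use. -/
theorem spectralData_of_hasSum (hS : Odd S) (h3 : 3 ≤ S) (hρ : Continuous ρ) (β : ℝ)
    {ι : Type} {e : ι → ℕ} (he : Function.Injective e) {lam : ι → ℝ} (hsum2 : Summable fun i => lam i ^ 2)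
    (htr : ∀ M' : ℕ, HasSum (fun i => lam i ^ (M' + 2)) (diagCyclicTraceU ρ β (M' + 2) (S := S) (G := G))) :
    ∃ top : ℝ,
      0 < top ∧ (∀ j, 0 ≤ posPad e lam j) ∧ (∀ j, 0 ≤ negPad e lam j) ∧ (∀ j, posPad e lam j ≤ top) ∧
      (∀ j, negPad e lam j ≤ top) ∧ (∃ j, posPad e lam j = top ∨ negPad e lam j = top) ∧
      Summable (fun j => posPad e lam j ^ 2) ∧ Summable (fun j => negPad e lam j ^ 2) ∧
      (∀ j, posPad e lam j = 0 ∨ negPad e lam j = 0) ∧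
      (∀ (m : ℕ) [NeZero m], 2 ≤ m →
        Summable (fun j => posPad e lam j ^ m) ∧ Summable (fun j => negPad e lam j ^ m) ∧
          ∑' j, posPad e lam j ^ m + (-1) ^ m * ∑' j, negPad e lam j ^ m = diagCyclicTraceU ρ β m (S := S) (G := G)) ∧
      (∀ m, 3 ≤ m → Odd m → ∑' j, negPad e lam j ^ m ≤ ∑' j, posPad e lam j ^ m) ∧
      ∑' j, negPad e lam j ^ S < ∑' j, posPad e lam j ^ S := by
  -- the trace formula at every `m ≥ 2`
  have htr' : ∀ (m : ℕ) [NeZero m], 2 ≤ m → HasSum (fun i => lam i ^ m) (diagCyclicTraceU ρ β m (S := S) (G := G)) := by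
    intro m _ hm
    obtain ⟨M', rfl⟩ : ∃ M', m = M' + 2 := ⟨m - 2, by omega⟩
    exact htr M'
  -- `|λᵢ| ≤ √T`, `T = Σ λ²`, hence `|λᵢ|^m` summable for `m ≥ 2`
  set T : ℝ := ∑' i, lam i ^ 2 with hT
  have hB : ∀ i, |lam i| ≤ Real.sqrt T := fun i =>
    Real.abs_le_sqrt (hsum2.le_tsum i fun j _ => sq_nonneg _)
  have habs : ∀ m, 2 ≤ m → Summable fun i => |lam i| ^ m := fun m hm => by
    have h : ∀ i, |lam i| ^ m = |lam i| ^ (m - 2) * lam i ^ 2 := fun i => by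
      rw [← sq_abs (lam i), ← pow_add, Nat.sub_add_cancel hm]
    simp_rw [h]
    refine (hsum2.mul_left (Real.sqrt T ^ (m - 2))).of_nonneg_of_le (fun i => by positivity) fun i => ?_
    exact mul_le_mul_of_nonneg_right (pow_le_pow_left₀ (abs_nonneg _) (hB i) _) (sq_nonneg _)
  -- positive / negative parts over `ι`
  set gp : ι → ℝ := fun i => max (lam i) 0 with hgp
  set gm : ι → ℝ := fun i => max (-lam i) 0 with hgm
  have hgp0 : ∀ i, 0 ≤ gp i := fun i => le_max_right _ _
  have hgm0 : ∀ i, 0 ≤ gm i := fun i => le_max_right _ _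
  have hgp_le : ∀ i, gp i ≤ |lam i| := fun i => max_le (le_abs_self _) (abs_nonneg _)
  have hgm_le : ∀ i, gm i ≤ |lam i| := fun i => max_le (neg_le_abs _) (abs_nonneg _)
  have hsp_i : ∀ m, 2 ≤ m → Summable fun i => gp i ^ m := fun m hm =>
    (habs m hm).of_nonneg_of_le (fun i => pow_nonneg (hgp0 i) _) fun i => pow_le_pow_left₀ (hgp0 i) (hgp_le i) _
  have hsm_i : ∀ m, 2 ≤ m → Summable fun i => gm i ^ m := fun m hm =>
    (habs m hm).of_nonneg_of_le (fun i => pow_nonneg (hgm0 i) _) fun i => pow_le_pow_left₀ (hgm0 i) (hgm_le i) _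
  -- the padded sequences over `ℕ`
  set sp : ℕ → ℝ := posPad e lam with hspdef
  set sm : ℕ → ℝ := negPad e lam with hsmdef
  have hsp_ext : sp = Function.extend e gp 0 := rfl
  have hsm_ext : sm = Function.extend e gm 0 := rfl
  have hsp_app : ∀ i, sp (e i) = gp i := fun i => by rw [hsp_ext]; exact he.extend_apply _ _ _
  have hsm_app : ∀ i, sm (e i) = gm i := fun i => by rw [hsm_ext]; exact he.extend_apply _ _ _
  have hsp_off : ∀ j, (¬ ∃ i, e i = j) → sp j = 0 := fun j hj => by
    rw [hsp_ext, Function.extend_apply' _ _ _ hj, Pi.zero_apply]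
  have hsm_off : ∀ j, (¬ ∃ i, e i = j) → sm j = 0 := fun j hj => by
    rw [hsm_ext, Function.extend_apply' _ _ _ hj, Pi.zero_apply]
  have hsp0 : ∀ j, 0 ≤ sp j := fun j => by
    by_cases hj : ∃ i, e i = j
    · obtain ⟨i, rfl⟩ := hj; rw [hsp_app]; exact hgp0 i
    · rw [hsp_off j hj]
  have hsm0 : ∀ j, 0 ≤ sm j := fun j => by
    by_cases hj : ∃ i, e i = j
    · obtain ⟨i, rfl⟩ := hj; rw [hsm_app]; exact hgm0 i
    · rw [hsm_off j hj]
  have hdisj : ∀ j, sp j = 0 ∨ sm j = 0 := fun j => by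
    by_cases hj : ∃ i, e i = j
    · obtain ⟨i, rfl⟩ := hj
      rw [hsp_app, hsm_app, hgp, hgm]
      rcases le_total 0 (lam i) with h | h
      · exact Or.inr (max_eq_right (neg_nonpos.2 h))
      · exact Or.inl (max_eq_right h)
    · exact Or.inl (hsp_off j hj)
  -- transfer of sums along `e`
  have hpow_sp : ∀ {m : ℕ}, m ≠ 0 → (fun j => sp j ^ m) = Function.extend e (fun i => gp i ^ m) 0 :=
    fun hm => by rw [hsp_ext]; exact pow_extend_zero e gp hm
  have hpow_sm : ∀ {m : ℕ}, m ≠ 0 → (fun j => sm j ^ m) = Function.extend e (fun i => gm i ^ m) 0 :=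
    fun hm => by rw [hsm_ext]; exact pow_extend_zero e gm hm
  have hHS_sp : ∀ m, 2 ≤ m → HasSum (fun j => sp j ^ m) (∑' i, gp i ^ m) := fun m hm => by
    rw [hpow_sp (by omega)]
    exact (hasSum_extend_zero he).2 (hsp_i m hm).hasSum
  have hHS_sm : ∀ m, 2 ≤ m → HasSum (fun j => sm j ^ m) (∑' i, gm i ^ m) := fun m hm => by
    rw [hpow_sm (by omega)]
    exact (hasSum_extend_zero he).2 (hsm_i m hm).hasSum
  -- the trace identities
  have htrace : ∀ (m : ℕ) [NeZero m], 2 ≤ m →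
      ∑' j, sp j ^ m + (-1) ^ m * ∑' j, sm j ^ m = diagCyclicTraceU ρ β m (S := S) (G := G) := by
    intro m _ hm
    rw [(hHS_sp m hm).tsum_eq, (hHS_sm m hm).tsum_eq, ← (htr' m hm).tsum_eq, ← tsum_mul_left,
      ← (hsp_i m hm).tsum_add ((hsm_i m hm).mul_left _)]
    exact tsum_congr fun i => (pow_eq_posPart_add_negPart (lam i) (by omega)).symm
  have hsq_sp : Summable fun j => sp j ^ 2 := (hHS_sp 2 le_rfl).summable
  have hsq_sm : Summable fun j => sm j ^ 2 := (hHS_sm 2 le_rfl).summable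
  -- odd traces are non-negative, the side trace is positive
  have hodd : ∀ m, 3 ≤ m → Odd m → ∑' j, sm j ^ m ≤ ∑' j, sp j ^ m := fun m hm hmo => by
    haveI : NeZero m := ⟨by omega⟩
    have h := htrace m (by omega)
    rw [hmo.neg_one_pow, neg_one_mul, ← sub_eq_add_neg] at h
    have h0 : 0 ≤ diagCyclicTraceU ρ β m (S := S) (G := G) := diagCyclicTraceU_nonneg ρ β m
    linarith
  have hside : ∑' j, sm j ^ S < ∑' j, sp j ^ S := by
    have h := htrace S (by omega)
    rw [hS.neg_one_pow, neg_one_mul, ← sub_eq_add_neg] at h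
    have h0 : 0 < diagCyclicTraceU ρ β S (S := S) (G := G) := diagCyclicTraceU_side_pos ρ β hS hρ
    linarith
  -- the top modulus
  set f : ℕ → ℝ := fun j => max (sp j) (sm j) with hf
  have hf0 : ∀ j, 0 ≤ f j := fun j => (hsp0 j).trans (le_max_left _ _)
  have hf_eq : ∀ j, f j = sp j + sm j := fun j => by
    rcases hdisj j with h | h
    · rw [hf]; dsimp only; rw [h, max_eq_right (hsm0 j), zero_add]
    · rw [hf]; dsimp only; rw [h, max_eq_left (hsp0 j), add_zero]
  have hf2 : Summable fun j => f j ^ 2 := by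
    have h : ∀ j, f j ^ 2 = sp j ^ 2 + sm j ^ 2 := fun j => by
      rcases hdisj j with h | h
      · rw [hf_eq, h, zero_add, zero_pow two_ne_zero, zero_add]
      · rw [hf_eq, h, add_zero, zero_pow two_ne_zero, add_zero]
    simp_rw [h]
    exact hsq_sp.add hsq_sm
  -- some modulus is positive (else all traces vanish)
  have hex : ∃ j₁, 0 < f j₁ := by
    by_contra hno
    push Not at hno
    have hz : ∀ j, sp j = 0 := fun j => le_antisymm ((le_max_left _ _).trans (hno j)) (hsp0 j)
    have hz' : ∀ j, sm j = 0 := fun j => le_antisymm ((le_max_right _ _).trans (hno j)) (hsm0 j)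
    have hS0 : S ≠ 0 := by omega
    simp only [hz, hz', zero_pow hS0, tsum_zero, lt_self_iff_false] at hside
  obtain ⟨j₁, hj₁⟩ := hex
  obtain ⟨j₀, hj₀, hmax⟩ := exists_max_of_summable_sq hf0 hf2 hj₁
  refine ⟨f j₀, hj₀, hsp0, hsm0, fun j => (le_max_left _ _).trans (hmax j),
    fun j => (le_max_right _ _).trans (hmax j), ⟨j₀, ?_⟩, hsq_sp, hsq_sm, hdisj,
    fun m _ hm => ⟨(hHS_sp m hm).summable, (hHS_sm m hm).summable, htrace m hm⟩, hodd, hside⟩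
  rcases max_choice (sp j₀) (sm j₀) with h | h
  · exact Or.inl h.symm
  · exact Or.inr h.symm

/-- ★★ **Spectral data of one diagonal slice** (odd side `S ≥ 3`, `β ≥ 0`, `ρ` continuous unitary): `exists_eigenPackage` +
`spectralData_of_hasSum` — sequences `sp, sm : ℕ → ℝ` and `top > 0` with the nine spectral fields of `DiagonalSliceModel` and the
trace identities `Σ' sp^m + (-1)^m Σ' sm^m = diagCyclicTraceU ρ β m` (`m ≥ 2`). -/
theorem exists_spectralData (hS : Odd S) (h3 : 3 ≤ S) (hρ : Continuous ρ) {β : ℝ} (hβ : 0 ≤ β)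
    (hρu : ∀ g, ρ g ∈ Matrix.unitaryGroup (Fin Nc) ℂ) :
    ∃ (sp sm : ℕ → ℝ) (top : ℝ),
      0 < top ∧ (∀ j, 0 ≤ sp j) ∧ (∀ j, 0 ≤ sm j) ∧ (∀ j, sp j ≤ top) ∧ (∀ j, sm j ≤ top) ∧
      (∃ j, sp j = top ∨ sm j = top) ∧ Summable (fun j => sp j ^ 2) ∧ Summable (fun j => sm j ^ 2) ∧
      (∀ j, sp j = 0 ∨ sm j = 0) ∧
      (∀ (m : ℕ) [NeZero m], 2 ≤ m →
        Summable (fun j => sp j ^ m) ∧ Summable (fun j => sm j ^ m) ∧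
          ∑' j, sp j ^ m + (-1) ^ m * ∑' j, sm j ^ m = diagCyclicTraceU ρ β m (S := S) (G := G)) ∧
      (∀ m, 3 ≤ m → Odd m → ∑' j, sm j ^ m ≤ ∑' j, sp j ^ m) ∧
      ∑' j, sm j ^ S < ∑' j, sp j ^ S := by
  obtain ⟨M, A, s, b, κ, -, -, -, -, -, -, hcount, hsum2, htr⟩ := exists_eigenPackage (S := S) ρ hρ hβ hρu
  haveI := hcount
  obtain ⟨e, he⟩ := Countable.exists_injective_nat s
  obtain ⟨top, h⟩ := spectralData_of_hasSum (S := S) (G := G) ρ hS h3 hρ β he hsum2 htr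
  exact ⟨posPad e κ, negPad e κ, top, h⟩

end SpectralData

end Summit.QuantumFields.YangMills.Cruxes.DiagonalMirrorRPR.SignTwistedDiagonalTrace.WilsonDiagonal

end
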